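import Literature.MathematicalPhysics.QuantumFieldTheory.WilsonWeakCouplingBounds
import Literature.MathematicalPhysics.QuantumFieldTheory.GaussianToolkit
import HarnessLib

/-!
# Lattice Maxwell theory: the Gaussian measures `τ_{E,θ,n}`, Lemma 13.1, Theorems 14.1, 14.2, and the block geometry of Theorem 14.3

S. Chatterjee, *The leading term of the Yang–Mills free energy*, J. Funct. Anal. 271 (2016),
arXiv:1602.01222, §§13–14 — fifth step of the inline proof of the named fact
`Literature.MathematicalPhysics.QuantumFieldTheory.chatterjee_freeEnergyDensity`. Everything is
proved; no named fact is introduced.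

All objects live on a TRANSLATED block `a + B_n` (so that the blocks of the multiscale argument of
Theorem 14.3 are covered by the same statements) with an arbitrary decidable pinned predicate `pin`
on edges (Chatterjee's pinned set `E`, required to contain the comb tree of the block where needed:
hypothesis `hpin`).

* `Free pin a n` (free edges), `glue` (the full edge function from pinned values `θ` and free values
  `s`), `sCirc` (circulation), `formM pin a n θ s = M_{E,θ,n}(s)`, `coeff`/`bterm` (the affine
  structure `s(q) = λ_q·s + b_q`, `sCirc_glue`), `Qmat = Σ_q λ_q λ_qᵀ` (`dotProduct_Qmat_mulVec`).
* **Lemma 13.1** `glue_zero_sq_le_l1_mul_formM` (`s(a+e)² ≤ |e|₁ M_0(s)`, from the abstract Poincaré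
  inequality `AxialGauge.sq_le_l1_mul_sum` in the additive group `ℝ`, applied to the translated
  configuration), `le_formM_zero`/`formM_zero_le`/`form_bounds` (`c_n‖s‖² ≤ M_0(s) ≤ C_n‖s‖²` with
  `c_n = (d²n^{d+1}+1)⁻¹`, crude `C_n = 16|B_n'|+1`), `posDef_Qmat`.
* `τ pin a n := multivariateGaussian 0 Q⁻¹` (`= Z⁻¹e^{-½M_0}ds`, `τ_eq_withDensity`),
  **Theorem 14.1** `theorem_14_1` (`τ(|s_e| ≤ η ∀ e ∈ A) ≥ (2η√(c_n/2π)e^{-C_nη²/2})^{|A|}`),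
  **Theorem 14.2** `theorem_14_2` (`∫ e^{-½M_θ} ≤ 2 ∫_{|s|_∞ ≤ R} e^{-½M_θ}`, `R = Rθ pin a n η_b`, for
  pinned values bounded by `η_b`; via completing the square `formM_eq_sq`, the mean bound
  `norm_mean_le`, and the union bound of `GaussianToolkit`).
* Block geometry for Theorem 14.3: `Touch`/`IsBdry` (the boundary set `A`), `blk`/`corner`,
  `shift_mem_of_touch` (a plaquette touching the interior of a block lies in the block),
  `isComb_or_isBdry_of_isComb` (block comb trees are pinned), the fine box `Amb m r` of side
  `fineN m r = r(m-1)+1`, block pinned sets `pinB`, the index equivalence `eqv`, and the form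
  decomposition `formM_amb_add_eq` (`M(t) + K₁ = M_b(t) + K₂` for configurations agreeing off the
  interior of `b`), `abs_ambE_le_of_pin`.

## References

* S. Chatterjee, *The leading term of the Yang–Mills free energy*, J. Funct. Anal. 271 (2016)
  2944–3005, arXiv:1602.01222, §13 (Lemma 13.1), §14 (Theorems 14.1–14.3). [arXiv160201222]
-/

noncomputable section

open MeasureTheory Measure ProbabilityTheory Finset Matrix WithLp
open scoped ENNReal NNReal
open Literature.Probability.LatticeModels Literature.MathematicalPhysics.QuantumLattice

namespace Literature.MathematicalPhysics.QuantumFieldTheory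

namespace LatticeMaxwell

open AxialGauge WilsonWeakCoupling GaussianToolkit

variable {d : ℕ}

/-- Sites of `ℤ^d`. -/
local notation "ZSite" => Literature.Probability.LatticeModels.Site

/-! ### Incidence: an edge lies in at most `4d` plaquettes -/

/-- The plaquettes of a region containing a given edge lie in the union of four families indexed by
a direction. [folklore] -/
theorem filter_plaquettesIn_edge_subset (Λ : Finset (ZSite d)) (y : ZSite d) (i : Fin d) :
    ((plaquettesIn Λ).filter fun p : Plaq d =>
        (p.1, p.2.1) = (y, i) ∨ (p.1 + Pi.single p.2.1 1, p.2.2) = (y, i) ∨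
          (p.1 + Pi.single p.2.2 1, p.2.1) = (y, i) ∨ (p.1, p.2.2) = (y, i)) ⊆
      ((univ.image fun k : Fin d => ((y, i, k) : Plaq d)) ∪
        (univ.image fun j : Fin d => ((y - Pi.single j 1, j, i) : Plaq d))) ∪
      ((univ.image fun k : Fin d => ((y - Pi.single k 1, i, k) : Plaq d)) ∪
        (univ.image fun j : Fin d => ((y, j, i) : Plaq d))) := by
  intro p hp
  obtain ⟨-, h⟩ := mem_filter.1 hp
  obtain ⟨x, j, k⟩ := p
  simp only [mem_union, mem_image, mem_univ, true_and]
  rcases h with h | h | h | h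
  · obtain ⟨rfl, rfl⟩ := Prod.mk_inj.1 h
    exact Or.inl (Or.inl ⟨k, rfl⟩)
  · obtain ⟨hx, rfl⟩ := Prod.mk_inj.1 h
    refine Or.inl (Or.inr ⟨j, ?_⟩)
    rw [← hx, add_sub_cancel_right]
  · obtain ⟨hx, rfl⟩ := Prod.mk_inj.1 h
    refine Or.inr (Or.inl ⟨k, ?_⟩)
    rw [← hx, add_sub_cancel_right]
  · obtain ⟨rfl, rfl⟩ := Prod.mk_inj.1 h
    exact Or.inr (Or.inr ⟨j, rfl⟩)

/-- **Each edge lies in at most `4d` plaquettes** of any region. [folklore] -/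
theorem card_filter_plaquettesIn_edge_le (Λ : Finset (ZSite d)) (e : ZdEdge d) :
    #((plaquettesIn Λ).filter fun p : Plaq d =>
        (p.1, p.2.1) = e ∨ (p.1 + Pi.single p.2.1 1, p.2.2) = e ∨
          (p.1 + Pi.single p.2.2 1, p.2.1) = e ∨ (p.1, p.2.2) = e) ≤ 4 * d := by
  obtain ⟨y, i⟩ := e
  refine (card_le_card (filter_plaquettesIn_edge_subset Λ y i)).trans ?_
  refine (card_union_le _ _).trans ?_
  have h4 : ∀ f : Fin d → Plaq d, #(univ.image f) ≤ d := fun f =>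
    card_image_le.trans (by rw [card_univ, Fintype.card_fin])
  have h1 := (card_union_le _ _).trans (add_le_add (h4 fun k => (y, i, k)) (h4 fun j => (y - Pi.single j 1, j, i)))
  have h2 := (card_union_le _ _).trans (add_le_add (h4 fun k => (y - Pi.single k 1, i, k)) (h4 fun j => (y, j, i)))
  omega

/-- The circulation `s(x,j,k) = s(x,x+e_j) + s(x+e_j,·+e_k) - s(x+e_k,·+e_j) - s(x,x+e_k)` of a
scalar edge function (§2, `t(x,j,k)`). [cite: arXiv160201222, §2] -/
def sCirc (H : ZdEdge d → ℝ) (p : Plaq d) : ℝ :=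
  H (p.1, p.2.1) + H (p.1 + Pi.single p.2.1 1, p.2.2) - H (p.1 + Pi.single p.2.2 1, p.2.1) - H (p.1, p.2.2)

/-! ### Translated boxes -/

/-- Translation of edges by a site `a`. [folklore] -/
def shiftE (a : ZSite d) : ZdEdge d ↪ ZdEdge d :=
  ⟨fun e => (e.1 + a, e.2), fun e e' h => by
    simp only [Prod.mk.injEq] at h
    exact Prod.ext (add_right_cancel h.1) h.2⟩

/-- `shiftE a e = (e.1 + a, e.2)`. [folklore] -/
@[simp] theorem shiftE_apply (a : ZSite d) (e : ZdEdge d) : shiftE a e = (e.1 + a, e.2) := rfl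

/-- The (positively oriented) edges of the translated vertex box `a + {0,…,n-1}^d`. [cite: arXiv160201222, §14] -/
def boxEdgesAt (a : ZSite d) (n : ℕ) : Finset (ZdEdge d) := (boxEdges d n).map (shiftE a)

/-- Membership in `boxEdgesAt`. [folklore] -/
theorem mem_boxEdgesAt {a : ZSite d} {n : ℕ} {e : ZdEdge d} :
    e ∈ boxEdgesAt a n ↔ (e.1 - a, e.2) ∈ boxEdges d n := by
  rw [boxEdgesAt, mem_map]
  constructor
  · rintro ⟨e', he', rfl⟩
    simpa using he'
  · intro h
    exact ⟨(e.1 - a, e.2), h, by simp⟩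

/-- `shiftE a e ∈ boxEdgesAt a n ↔ e ∈ boxEdges d n`. [folklore] -/
theorem shiftE_mem_boxEdgesAt {a : ZSite d} {n : ℕ} {e : ZdEdge d} :
    shiftE a e ∈ boxEdgesAt a n ↔ e ∈ boxEdges d n := by
  rw [mem_boxEdgesAt]; simp

/-- `boxEdgesAt` has the cardinality of `boxEdges`. [folklore] -/
theorem card_boxEdgesAt (a : ZSite d) (n : ℕ) : #(boxEdgesAt a n) = #(boxEdges d n) := by
  rw [boxEdgesAt, card_map]

/-- Plaquettes of a translated configuration, additive version of `plaquette_translate`. [folklore] -/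
theorem sCirc_shift (H : ZdEdge d → ℝ) (a : ZSite d) (p : Plaq d) :
    sCirc H (Plaq.shift a p) = sCirc (fun e => H (e.1 + a, e.2)) p := by
  simp only [sCirc, Plaq.shift_fst, Plaq.shift_snd, add_right_comm _ (Pi.single _ _) a]

/-! ### The scalar lattice Maxwell forms with pinned edges (§13) -/

section Forms

variable (pin : ZdEdge d → Prop) [DecidablePred pin] (a : ZSite d)

/-- The free (unpinned) edges of the block `a + B_n` for the pinned predicate `pin` (Chatterjee's
`E_n ∖ E`; for `a = 0`, `pin = IsComb` this is `WilsonWeakCoupling.FreeIdx d n = E_n^1` up to the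
trivial translation). [cite: arXiv160201222, §13] -/
abbrev Free (n : ℕ) : Type := {e : ↥(boxEdgesAt a n) // ¬ pin e.1}

variable {pin}

/-- The full edge function glued from the pinned values `θ` (on pinned edges of the block) and the
free values `s`; `0` off the block (Chatterjee arXiv:1602.01222 §13: "extend `t` to `s` by
`s = θ` on `E`"). [cite: arXiv160201222, §13] -/
def glue (n : ℕ) (θ : ZdEdge d → ℝ) (s : Free pin a n → ℝ) : ZdEdge d → ℝ := fun e =>
  if h : e ∈ boxEdgesAt a n then (if hp : pin e then θ e else s ⟨⟨e, h⟩, hp⟩) else 0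

variable (pin) in
/-- **The lattice Maxwell form with boundary values** on the block `a + B_n`:
`M_{E,θ,n}(s) = Σ_{p ∈ (a+B_n)'} s(p)²`, the plaquettes of the block being labelled by the
plaquettes of `B_n` via `Plaq.shift a` (Chatterjee arXiv:1602.01222 §13). [cite: arXiv160201222, §13] -/
def formM (n : ℕ) (θ : ZdEdge d → ℝ) (s : Free pin a n → ℝ) : ℝ :=
  ∑ p ∈ plaquettesIn (halfOpenBox d n), (sCirc (glue a n θ s) (Plaq.shift a p)) ^ 2

variable {a} {n : ℕ}

/-- `glue` on a free edge. [folklore] -/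
theorem glue_apply_free (θ : ZdEdge d → ℝ) (s : Free pin a n → ℝ) (e : Free pin a n) :
    glue a n θ s e.1.1 = s e := by
  obtain ⟨⟨e, he⟩, hp⟩ := e
  simp [glue, he, hp]

/-- `glue` on a pinned edge of the block. [folklore] -/
theorem glue_apply_pin (θ : ZdEdge d → ℝ) (s : Free pin a n → ℝ) {e : ZdEdge d} (he : e ∈ boxEdgesAt a n)
    (hp : pin e) : glue a n θ s e = θ e := by
  simp [glue, he, hp]

/-- `glue` off the block. [folklore] -/
theorem glue_apply_of_not_mem (θ : ZdEdge d → ℝ) (s : Free pin a n → ℝ) {e : ZdEdge d}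
    (he : e ∉ boxEdgesAt a n) : glue a n θ s e = 0 := by
  simp [glue, he]

/-- `glue` is additive in `(θ, s)`: `glue θ s = glue θ 0 + glue 0 s`. [folklore] -/
theorem glue_eq_add (θ : ZdEdge d → ℝ) (s : Free pin a n → ℝ) (e : ZdEdge d) :
    glue a n θ s e = glue a n θ (0 : Free pin a n → ℝ) e + glue a n (0 : ZdEdge d → ℝ) s e := by
  unfold glue
  split_ifs <;> simp

/-- The free part of `glue` as a sum over free edges. [folklore] -/
theorem glue_zero_eq_sum (s : Free pin a n → ℝ) (e' : ZdEdge d) :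
    glue a n (0 : ZdEdge d → ℝ) s e' = ∑ e : Free pin a n, s e * (if e.1.1 = e' then 1 else 0) := by
  by_cases h : e' ∈ boxEdgesAt a n
  · by_cases hp : pin e'
    · rw [glue_apply_pin _ _ h hp, Pi.zero_apply]
      symm
      refine Finset.sum_eq_zero fun e _ => ?_
      rw [if_neg, mul_zero]
      intro hee; exact e.2 (hee ▸ hp)
    · have : glue a n (0 : ZdEdge d → ℝ) s e' = s ⟨⟨e', h⟩, hp⟩ := glue_apply_free 0 s ⟨⟨e', h⟩, hp⟩
      rw [this, Finset.sum_eq_single ⟨⟨e', h⟩, hp⟩]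
      · simp
      · intro e _ hne
        rw [if_neg, mul_zero]
        intro hee; apply hne
        exact Subtype.ext (Subtype.ext hee)
      · simp
  · rw [glue_apply_of_not_mem _ _ h]
    symm
    refine Finset.sum_eq_zero fun e _ => ?_
    rw [if_neg, mul_zero]
    intro hee; exact h (hee ▸ e.1.2)

/-- The indicator coefficient of the edge `e` in the circulation around `q`. [folklore] -/
def coeffAux (e : ZdEdge d) (q : Plaq d) : ℝ :=
  (if e = (q.1, q.2.1) then 1 else 0) + (if e = (q.1 + Pi.single q.2.1 1, q.2.2) then 1 else 0) -
    (if e = (q.1 + Pi.single q.2.2 1, q.2.1) then 1 else 0) - (if e = (q.1, q.2.2) then 1 else 0)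

variable (pin a n) in
/-- The coefficient vector `λ_q ∈ ℝ^{free edges}` of the linear form `s ↦ s(q)` (circulation of the
free part around the plaquette `q`). [cite: arXiv160201222, §13] -/
def coeff (q : Plaq d) : Free pin a n → ℝ := fun e => coeffAux e.1.1 q

variable (pin a n) in
/-- The constant `b_q = θ(q)` contributed by the pinned values to the circulation around `q`. [cite: arXiv160201222, §13] -/
def bterm (θ : ZdEdge d → ℝ) (q : Plaq d) : ℝ := sCirc (glue (pin := pin) a n θ 0) q

/-- `|coeffAux e q| ≤ 2`. [folklore] -/
theorem abs_coeffAux_le (e : ZdEdge d) (q : Plaq d) : |coeffAux e q| ≤ 2 := by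
  unfold coeffAux
  split_ifs <;> norm_num

/-- `coeffAux e q = 0` unless `e` is one of the four edges of `q`. [folklore] -/
theorem coeffAux_eq_zero {e : ZdEdge d} {q : Plaq d}
    (h : ¬ ((q.1, q.2.1) = e ∨ (q.1 + Pi.single q.2.1 1, q.2.2) = e ∨
      (q.1 + Pi.single q.2.2 1, q.2.1) = e ∨ (q.1, q.2.2) = e)) : coeffAux e q = 0 := by
  unfold coeffAux
  push Not at h
  obtain ⟨h1, h2, h3, h4⟩ := h
  rw [if_neg (Ne.symm h1), if_neg (Ne.symm h2), if_neg (Ne.symm h3), if_neg (Ne.symm h4)]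
  ring

/-- **The circulation is affine in the free variables**: `s(q) = λ_q · s + b_q`. [cite: arXiv160201222, §13] -/
theorem sCirc_glue (θ : ZdEdge d → ℝ) (s : Free pin a n → ℝ) (q : Plaq d) :
    sCirc (glue a n θ s) q = coeff pin a n q ⬝ᵥ s + bterm pin a n θ q := by
  have hfree : sCirc (glue a n (0 : ZdEdge d → ℝ) s) q = coeff pin a n q ⬝ᵥ s := by
    simp only [sCirc, glue_zero_eq_sum, coeff, coeffAux, dotProduct]
    rw [← Finset.sum_add_distrib, ← Finset.sum_sub_distrib, ← Finset.sum_sub_distrib]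
    refine Finset.sum_congr rfl fun e _ => ?_
    ring
  rw [bterm, ← hfree]
  simp only [sCirc, glue_eq_add θ s]
  ring

/-- The homogeneous form is the quadratic form `Σ_p (λ_{a+p} · s)²`. [cite: arXiv160201222, §13] -/
theorem formM_zero_eq (s : Free pin a n → ℝ) :
    formM pin a n 0 s = ∑ p ∈ plaquettesIn (halfOpenBox d n), (coeff pin a n (Plaq.shift a p) ⬝ᵥ s) ^ 2 := by
  unfold formM
  refine Finset.sum_congr rfl fun p _ => ?_
  rw [sCirc_glue, bterm]
  have : sCirc (glue a n (0 : ZdEdge d → ℝ) (0 : Free pin a n → ℝ)) (Plaq.shift a p) = 0 := by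
    simp [sCirc, glue_zero_eq_sum]
  rw [this, add_zero]

/-- The general form: `M_θ(s) = Σ_p (λ_{a+p} · s + b_{a+p})²`. [cite: arXiv160201222, §13] -/
theorem formM_eq (θ : ZdEdge d → ℝ) (s : Free pin a n → ℝ) :
    formM pin a n θ s = ∑ p ∈ plaquettesIn (halfOpenBox d n),
      (coeff pin a n (Plaq.shift a p) ⬝ᵥ s + bterm pin a n θ (Plaq.shift a p)) ^ 2 := by
  unfold formM
  exact Finset.sum_congr rfl fun p _ => by rw [sCirc_glue]

variable (pin a n) in
/-- **The precision matrix** `Q = Σ_p λ_p λ_pᵀ` of the homogeneous lattice Maxwell form: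
`sᵀ Q s = M_{E,0,n}(s)`. [cite: arXiv160201222, §13] -/
def Qmat : Matrix (Free pin a n) (Free pin a n) ℝ :=
  ∑ p ∈ plaquettesIn (halfOpenBox d n), vecMulVec (coeff pin a n (Plaq.shift a p)) (coeff pin a n (Plaq.shift a p))

/-- `sᵀ Q s = M_0(s)`. [cite: arXiv160201222, §13] -/
theorem dotProduct_Qmat_mulVec (s : Free pin a n → ℝ) : s ⬝ᵥ Qmat pin a n *ᵥ s = formM pin a n 0 s := by
  rw [formM_zero_eq, Qmat, Matrix.sum_mulVec, dotProduct_sum]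
  refine Finset.sum_congr rfl fun p _ => ?_
  have h1 : vecMulVec (coeff pin a n (Plaq.shift a p)) (coeff pin a n (Plaq.shift a p)) *ᵥ s =
      (coeff pin a n (Plaq.shift a p) ⬝ᵥ s) • coeff pin a n (Plaq.shift a p) := by
    ext i
    simp only [Matrix.mulVec, vecMulVec_apply, dotProduct, Pi.smul_apply, smul_eq_mul, Finset.sum_mul]
    exact Finset.sum_congr rfl fun j _ => by ring
  rw [h1, dotProduct_smul, smul_eq_mul, dotProduct_comm, sq]

omit [DecidablePred pin] in
/-- `Q` is symmetric. [folklore] -/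
theorem Qmat_transpose : (Qmat pin a n)ᵀ = Qmat pin a n := by
  rw [Qmat, Matrix.transpose_sum]
  exact Finset.sum_congr rfl fun p _ => by rw [Matrix.transpose_vecMulVec]

end Forms

/-! ### Lemma 13.1: form bounds -/

section Bounds

variable {pin : ZdEdge d → Prop} [DecidablePred pin] {a : ZSite d} {n : ℕ}

/-- Squared Euclidean norm of a free configuration. [folklore] -/
theorem norm_toLp_sq (s : Free pin a n → ℝ) :
    ‖(WithLp.toLp 2 s : EuclideanSpace ℝ (Free pin a n))‖ ^ 2 = ∑ e, s e ^ 2 := by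
  rw [EuclideanSpace.real_norm_sq_eq]

/-- `(glue 0 s e)² ≤ ‖s‖²` for every edge. [folklore] -/
theorem glue_zero_sq_le (s : Free pin a n → ℝ) (e : ZdEdge d) :
    (glue a n (0 : ZdEdge d → ℝ) s e) ^ 2 ≤ ∑ e', s e' ^ 2 := by
  have h0 : (0 : ℝ) ^ 2 ≤ ∑ e', s e' ^ 2 := by
    rw [zero_pow two_ne_zero]; exact Finset.sum_nonneg fun _ _ => sq_nonneg _
  by_cases h : e ∈ boxEdgesAt a n
  · by_cases hp : pin e
    · rw [glue_apply_pin _ _ h hp, Pi.zero_apply]; exact h0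
    · have : glue a n (0 : ZdEdge d → ℝ) s e = s ⟨⟨e, h⟩, hp⟩ := glue_apply_free 0 s ⟨⟨e, h⟩, hp⟩
      rw [this]
      exact Finset.single_le_sum (f := fun e' => s e' ^ 2) (fun _ _ => sq_nonneg _) (mem_univ _)
  · rw [glue_apply_of_not_mem _ _ h]; exact h0

/-- **Crude upper form bound**: `M_0(s) ≤ 16 |B_n'| ‖s‖²`. (Chatterjee's Lemma 13.1 has the sharp
`C₂‖s‖²` with `C₂` depending only on `d`; any polynomial bound suffices downstream.) [cite: arXiv160201222, Lemma 13.1] -/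
theorem formM_zero_le (s : Free pin a n → ℝ) :
    formM pin a n 0 s ≤ 16 * #(plaquettesIn (halfOpenBox d n)) * ∑ e, s e ^ 2 := by
  unfold formM
  calc ∑ p ∈ plaquettesIn (halfOpenBox d n), (sCirc (glue a n (0 : ZdEdge d → ℝ) s) (Plaq.shift a p)) ^ 2
      ≤ ∑ _p ∈ plaquettesIn (halfOpenBox d n), 16 * ∑ e, s e ^ 2 := by
        refine Finset.sum_le_sum fun p _ => ?_
        set q := Plaq.shift a p
        unfold sCirc
        have h1 := glue_zero_sq_le s (q.1, q.2.1)
        have h2 := glue_zero_sq_le s (q.1 + Pi.single q.2.1 1, q.2.2)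
        have h3 := glue_zero_sq_le s (q.1 + Pi.single q.2.2 1, q.2.1)
        have h4 := glue_zero_sq_le s (q.1, q.2.2)
        nlinarith [sq_nonneg (glue a n (0 : ZdEdge d → ℝ) s (q.1, q.2.1) - glue a n 0 s (q.1 + Pi.single q.2.1 1, q.2.2)),
          sq_nonneg (glue a n (0 : ZdEdge d → ℝ) s (q.1 + Pi.single q.2.2 1, q.2.1) - glue a n 0 s (q.1, q.2.2)),
          sq_nonneg (glue a n (0 : ZdEdge d → ℝ) s (q.1, q.2.1) + glue a n 0 s (q.1 + Pi.single q.2.1 1, q.2.2)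
            + glue a n 0 s (q.1 + Pi.single q.2.2 1, q.2.1) + glue a n 0 s (q.1, q.2.2))]
    _ = 16 * #(plaquettesIn (halfOpenBox d n)) * ∑ e, s e ^ 2 := by
        rw [Finset.sum_const, nsmul_eq_mul]; ring

/-- **Lemma 13.1 (discrete Poincaré inequality for the Maxwell form)**: if the pinned set contains
the (translated) comb tree, then for every edge `a + e` of the block, `s(a+e)² ≤ |e|₁ M_0(s)`
(printed: `|s(x,y)| ≤ |x|₁ √M_n(s)`), by the abstract Poincaré inequality
`AxialGauge.sq_le_l1_mul_sum` in the additive group `ℝ`, applied to the translated configuration. [cite: arXiv160201222, Lemma 13.1] -/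
theorem glue_zero_sq_le_l1_mul_formM (hpin : ∀ e ∈ boxEdges d n, IsComb e → pin (shiftE a e))
    (s : Free pin a n → ℝ) {e : ZdEdge d} (he : e ∈ boxEdges d n) :
    (glue a n (0 : ZdEdge d → ℝ) s (shiftE a e)) ^ 2 ≤ l1 e.1 * formM pin a n 0 s := by
  set U : ZdGaugeConfig d (Multiplicative ℝ) :=
    fun e' => Multiplicative.ofAdd (glue a n (0 : ZdEdge d → ℝ) s (shiftE a e')) with hU
  have h := sq_le_l1_mul_sum (G := Multiplicative ℝ) (ℓ := fun g => |Multiplicative.toAdd g|)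
    (fun _ => abs_nonneg _) (fun x y => by simpa using abs_add_le (Multiplicative.toAdd x) (Multiplicative.toAdd y))
    (fun x => by simp) (n := n) (U := U)
    (fun e' he' hc => by
      have h0 := glue_apply_pin (0 : ZdEdge d → ℝ) s (shiftE_mem_boxEdgesAt.2 he') (hpin e' he' hc)
      simp only [shiftE_apply, Pi.zero_apply] at h0
      simp [hU, h0]) he
  have hplaq : ∀ p : Plaq d, |Multiplicative.toAdd (U.plaquette p.1 p.2.1 p.2.2)| =
      |sCirc (glue a n (0 : ZdEdge d → ℝ) s) (Plaq.shift a p)| := fun p => by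
    rw [sCirc_shift]
    simp only [ZdGaugeConfig.plaquette, hU, sCirc, toAdd_mul, toAdd_inv, toAdd_ofAdd, shiftE_apply]
    ring_nf
  simp only [hplaq, sq_abs] at h
  simpa [hU, formM] using h

/-- **Lower form bound**: with the comb tree pinned, `M_0(s) ≥ ‖s‖² / (d² n^{d+1} + 1)`. [cite: arXiv160201222, Lemma 13.1] -/
theorem le_formM_zero (hpin : ∀ e ∈ boxEdges d n, IsComb e → pin (shiftE a e)) (s : Free pin a n → ℝ) :
    ((d : ℝ) ^ 2 * (n : ℝ) ^ (d + 1) + 1)⁻¹ * ∑ e, s e ^ 2 ≤ formM pin a n 0 s := by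
  have hM : 0 ≤ formM pin a n 0 s := Finset.sum_nonneg fun _ _ => sq_nonneg _
  have hedge : ∀ e : Free pin a n, s e ^ 2 ≤ d * n * formM pin a n 0 s := fun e => by
    have hmem : (e.1.1.1 - a, e.1.1.2) ∈ boxEdges d n := mem_boxEdgesAt.1 e.1.2
    have h := glue_zero_sq_le_l1_mul_formM hpin s hmem
    have hback : shiftE a (e.1.1.1 - a, e.1.1.2) = e.1.1 := by simp
    rw [hback, glue_apply_free] at h
    refine h.trans (mul_le_mul_of_nonneg_right ?_ hM)
    exact_mod_cast l1_le (mem_boxEdges.1 hmem).1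
  have hsum : ∑ e, s e ^ 2 ≤ Fintype.card (Free pin a n) * (d * n * formM pin a n 0 s) := by
    calc ∑ e, s e ^ 2 ≤ ∑ _e : Free pin a n, d * n * formM pin a n 0 s := Finset.sum_le_sum fun e _ => hedge e
      _ = _ := by rw [Finset.sum_const, Finset.card_univ, nsmul_eq_mul]
  have hcard : (Fintype.card (Free pin a n) : ℝ) ≤ d * n ^ d := by
    have h1 : Fintype.card (Free pin a n) ≤ #(boxEdges d n) := by
      rw [Fintype.card_subtype, ← card_boxEdgesAt a n]
      exact (card_filter_le _ _).trans (by rw [Finset.card_univ, Fintype.card_coe])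
    exact_mod_cast h1.trans (card_boxEdges_le n)
  have hpos : 0 < (d : ℝ) ^ 2 * (n : ℝ) ^ (d + 1) + 1 := by positivity
  rw [inv_mul_le_iff₀ hpos]
  calc ∑ e, s e ^ 2 ≤ Fintype.card (Free pin a n) * (d * n * formM pin a n 0 s) := hsum
    _ ≤ (d * n ^ d) * (d * n * formM pin a n 0 s) := by gcongr
    _ = (d : ℝ) ^ 2 * (n : ℝ) ^ (d + 1) * formM pin a n 0 s := by ring
    _ ≤ ((d : ℝ) ^ 2 * (n : ℝ) ^ (d + 1) + 1) * formM pin a n 0 s := by nlinarith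

variable (d n) in
/-- The lower constant `c_n = (d² n^{d+1} + 1)⁻¹` of Lemma 13.1. [cite: arXiv160201222, Lemma 13.1] -/
def cLow : ℝ := ((d : ℝ) ^ 2 * (n : ℝ) ^ (d + 1) + 1)⁻¹

variable (d n) in
/-- The (crude) upper constant `C_n = 16 |B_n'| + 1`. [cite: arXiv160201222, Lemma 13.1] -/
def cUp : ℝ := 16 * #(plaquettesIn (halfOpenBox d n)) + 1

/-- `c_n > 0`. [folklore] -/
theorem cLow_pos : 0 < cLow d n := by unfold cLow; positivity

/-- `c_n ≤ 1`. [folklore] -/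
theorem cLow_le_one : cLow d n ≤ 1 := by
  unfold cLow
  exact inv_le_one_of_one_le₀ (by nlinarith [show (0:ℝ) ≤ (d : ℝ) ^ 2 * (n : ℝ) ^ (d + 1) by positivity])

/-- `C_n > 0`. [folklore] -/
theorem cUp_pos : 0 < cUp d n := by unfold cUp; positivity

/-- The form bounds in the shape used by `GaussianToolkit`. [cite: arXiv160201222, Lemma 13.1] -/
theorem form_bounds (hpin : ∀ e ∈ boxEdges d n, IsComb e → pin (shiftE a e)) (v : Free pin a n → ℝ) :
    cLow d n * ‖(WithLp.toLp 2 v : EuclideanSpace ℝ (Free pin a n))‖ ^ 2 ≤ v ⬝ᵥ Qmat pin a n *ᵥ v ∧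
      v ⬝ᵥ Qmat pin a n *ᵥ v ≤ cUp d n * ‖(WithLp.toLp 2 v : EuclideanSpace ℝ (Free pin a n))‖ ^ 2 := by
  rw [dotProduct_Qmat_mulVec, norm_toLp_sq]
  refine ⟨le_formM_zero hpin v, (formM_zero_le v).trans ?_⟩
  unfold cUp
  have : 0 ≤ ∑ e, v e ^ 2 := Finset.sum_nonneg fun _ _ => sq_nonneg _
  nlinarith

/-- **The precision matrix is positive definite** (with the comb tree pinned). [cite: arXiv160201222, §13] -/
theorem posDef_Qmat (hpin : ∀ e ∈ boxEdges d n, IsComb e → pin (shiftE a e)) : (Qmat pin a n).PosDef := by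
  refine Matrix.PosDef.of_dotProduct_mulVec_pos ?_ fun v hv => ?_
  · rw [Matrix.IsHermitian, Matrix.conjTranspose_eq_transpose_of_trivial, Qmat_transpose]
  · simp only [star_trivial]
    have h := (form_bounds hpin v).1
    have hn : 0 < ‖(WithLp.toLp 2 v : EuclideanSpace ℝ (Free pin a n))‖ ^ 2 := by
      have : (WithLp.toLp 2 v : EuclideanSpace ℝ (Free pin a n)) ≠ 0 := by
        intro h0; apply hv; funext e
        have := congr_arg (fun x : EuclideanSpace ℝ (Free pin a n) => x e) h0
        simpa using this
      positivity
    exact lt_of_lt_of_le (mul_pos cLow_pos hn) h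

end Bounds

/-! ### The Gaussian measure `τ`, Theorem 14.1 -/

section Gaussian

variable (pin : ZdEdge d → Prop) [DecidablePred pin] (a : ZSite d) (n : ℕ)

/-- **Lattice Maxwell theory** `τ_{E,0,n}`: the centred Gaussian probability measure on `ℝ^{free edges}`
with density `∝ e^{-½ M_{E,0,n}(s)}`, realised as Mathlib's `multivariateGaussian 0 Q⁻¹`
(Chatterjee arXiv:1602.01222 §13, `τ_{E,0,n}`; `τ_n` for `E = E_n^0`). [cite: arXiv160201222, §13] -/
def τ : Measure (EuclideanSpace ℝ (Free pin a n)) := multivariateGaussian 0 (Qmat pin a n)⁻¹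

/-- `τ` is a probability measure. [folklore] -/
instance : IsProbabilityMeasure (τ pin a n) := by unfold τ; infer_instance

variable {pin a n}

/-- The Gaussian weight of `Q` is `e^{-½ M_0}`. [cite: arXiv160201222, §13] -/
theorem gaussWeight_Qmat (s : EuclideanSpace ℝ (Free pin a n)) :
    gaussWeight (Qmat pin a n) s = ENNReal.ofReal (Real.exp (-(formM pin a n 0 (ofLp s)) / 2)) := by
  rw [gaussWeight, dotProduct_Qmat_mulVec]

/-- `τ = Z⁻¹ e^{-½ M_0(s)} ds` with `Z = gaussZ Q ∈ (0, ∞)` (with the comb tree pinned). [cite: arXiv160201222, §13] -/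
theorem τ_eq_withDensity (hpin : ∀ e ∈ boxEdges d n, IsComb e → pin (shiftE a e)) :
    τ pin a n = (gaussZ (Qmat pin a n))⁻¹ • (volume : Measure (EuclideanSpace ℝ (Free pin a n))).withDensity (gaussWeight (Qmat pin a n)) ∧
      gaussZ (Qmat pin a n) ≠ 0 ∧ gaussZ (Qmat pin a n) ≠ ∞ :=
  multivariateGaussian_inv_eq_withDensity (posDef_Qmat hpin)

/-- **Theorem 14.1 (small pinning probabilities)**: for the comb tree pinned, every set `A` of free
edges and `0 < η`,
`τ(|s_e| ≤ η ∀ e ∈ A) ≥ (2η (c_n/2π)^{1/2} e^{-C_n η²/2})^{|A|}`; with `c_n = (d²n^{d+1}+1)⁻¹`,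
`C_n = 16|B_n'|+1` this is `≥ e^{-C|A|(log(1/η) + log n)}` for `η ≤ 1/2` as printed. [cite: arXiv160201222, Thm. 14.1] -/
theorem theorem_14_1 (hpin : ∀ e ∈ boxEdges d n, IsComb e → pin (shiftE a e)) (A : Finset (Free pin a n)) {η : ℝ} (hη : 0 < η) :
    ENNReal.ofReal ((2 * η * (Real.sqrt (cLow d n) / Real.sqrt (2 * Real.pi)) * Real.exp (-(cUp d n * η ^ 2 / 2))) ^ A.card) ≤
      τ pin a n {s | ∀ e ∈ A, |s e| ≤ η} :=
  le_multivariateGaussian_cube (posDef_Qmat hpin) cLow_pos cUp_pos (fun v => (form_bounds hpin v).1)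
    (fun v => (form_bounds hpin v).2) A hη

end Gaussian

/-! ### Theorem 14.2: boundary values shift the mean; sup-norm bound with probability `≥ 1/2` -/

section Theorem142

variable {pin : ZdEdge d → Prop} [DecidablePred pin] {a : ZSite d} {n : ℕ}

variable (pin a n) in
/-- The linear coefficient `v_θ = Σ_p b_p λ_p` of `M_θ` (so `M_θ(s) = sᵀQs + 2 v_θ·s + Σ_p b_p²`). [cite: arXiv160201222, Thm. 14.2 (proof)] -/
def vvec (θ : ZdEdge d → ℝ) : Free pin a n → ℝ :=
  ∑ p ∈ plaquettesIn (halfOpenBox d n), bterm pin a n θ (Plaq.shift a p) • coeff pin a n (Plaq.shift a p)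

variable (pin a n) in
/-- The mean `μ_θ = -Q⁻¹ v_θ` of the Gaussian measure `τ_{E,θ,n}` (Chatterjee's `μ = -Σ v`,
(12.x) `musigma2`). [cite: arXiv160201222, §12 and Thm. 14.2 (proof)] -/
def mean (θ : ZdEdge d → ℝ) : Free pin a n → ℝ := -((Qmat pin a n)⁻¹ *ᵥ vvec pin a n θ)

variable (pin a n) in
/-- The constant `K_θ = Σ_p b_p² - μᵀ Q μ` in the completed square. [folklore] -/
def Kconst (θ : ZdEdge d → ℝ) : ℝ :=
  (∑ p ∈ plaquettesIn (halfOpenBox d n), bterm pin a n θ (Plaq.shift a p) ^ 2) - mean pin a n θ ⬝ᵥ Qmat pin a n *ᵥ mean pin a n θ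

/-- **Completing the square**: `M_θ(s) = (s - μ_θ)ᵀ Q (s - μ_θ) + K_θ` (with the comb tree pinned,
so that `Q` is invertible). [cite: arXiv160201222, Thm. 14.2 (proof)] -/
theorem formM_eq_sq (hpin : ∀ e ∈ boxEdges d n, IsComb e → pin (shiftE a e)) (θ : ZdEdge d → ℝ) (s : Free pin a n → ℝ) :
    formM pin a n θ s = (s - mean pin a n θ) ⬝ᵥ Qmat pin a n *ᵥ (s - mean pin a n θ) + Kconst pin a n θ := by
  set Q := Qmat pin a n with hQ
  set v := vvec pin a n θ with hv
  set m := mean pin a n θ with hm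
  have hu := (Matrix.isUnit_iff_isUnit_det _).1 (posDef_Qmat hpin).isUnit
  -- `Q μ = -v`
  have hQm : Q *ᵥ m = -v := by
    rw [hm, mean, Matrix.mulVec_neg, Matrix.mulVec_mulVec, ← hQ, Matrix.mul_nonsing_inv _ hu, Matrix.one_mulVec]
  -- expand `M_θ`
  have hlin : ∑ p ∈ plaquettesIn (halfOpenBox d n), bterm pin a n θ (Plaq.shift a p) * (coeff pin a n (Plaq.shift a p) ⬝ᵥ s) = v ⬝ᵥ s := by
    rw [hv, vvec, sum_dotProduct]
    exact Finset.sum_congr rfl fun p _ => by rw [smul_dotProduct, smul_eq_mul]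
  have hexp : formM pin a n θ s = s ⬝ᵥ Q *ᵥ s + 2 * (v ⬝ᵥ s) + ∑ p ∈ plaquettesIn (halfOpenBox d n), bterm pin a n θ (Plaq.shift a p) ^ 2 := by
    rw [formM_eq, dotProduct_Qmat_mulVec, formM_zero_eq, ← hlin, Finset.mul_sum, ← Finset.sum_add_distrib,
      ← Finset.sum_add_distrib]
    exact Finset.sum_congr rfl fun p _ => by ring
  -- expand the square
  have hsq : (s - m) ⬝ᵥ Q *ᵥ (s - m) = s ⬝ᵥ Q *ᵥ s + 2 * (v ⬝ᵥ s) + m ⬝ᵥ Q *ᵥ m := by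
    have h1 : s ⬝ᵥ Q *ᵥ m = -(v ⬝ᵥ s) := by rw [hQm, dotProduct_neg, dotProduct_comm]
    have h2 : m ⬝ᵥ Q *ᵥ s = -(v ⬝ᵥ s) := by
      rw [Matrix.dotProduct_mulVec, ← Matrix.mulVec_transpose, Qmat_transpose, ← hQ, hQm, neg_dotProduct]
    rw [Matrix.mulVec_sub, sub_dotProduct, dotProduct_sub, dotProduct_sub, h1, h2]
    ring
  rw [hexp, hsq, Kconst, ← hm, ← hQ]
  ring

variable (pin a n) in
/-- The unnormalised weight `e^{-½ M_θ(s)}` of `τ_{E,θ,n}`. [cite: arXiv160201222, §13] -/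
def wθ (θ : ZdEdge d → ℝ) (s : EuclideanSpace ℝ (Free pin a n)) : ℝ≥0∞ :=
  ENNReal.ofReal (Real.exp (-(formM pin a n θ (ofLp s)) / 2))

/-- `e^{-½M_θ(s)} = e^{-K/2} · e^{-½ (s-μ)ᵀQ(s-μ)}`. [cite: arXiv160201222, Thm. 14.2 (proof)] -/
theorem wθ_eq (hpin : ∀ e ∈ boxEdges d n, IsComb e → pin (shiftE a e)) (θ : ZdEdge d → ℝ) (s : EuclideanSpace ℝ (Free pin a n)) :
    wθ pin a n θ s = ENNReal.ofReal (Real.exp (-(Kconst pin a n θ) / 2)) *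
      gaussWeight (Qmat pin a n) (s - WithLp.toLp 2 (mean pin a n θ)) := by
  rw [wθ, gaussWeight, formM_eq_sq hpin, ← ENNReal.ofReal_mul (Real.exp_pos _).le, ← Real.exp_add]
  congr 2
  simp only [WithLp.ofLp_sub]
  ring

/-- The Maxwell form is continuous in the free variables. [folklore] -/
theorem continuous_formM (θ : ZdEdge d → ℝ) : Continuous (formM pin a n θ) := by
  unfold formM
  refine continuous_finsetSum _ fun p _ => ?_
  refine (Continuous.pow ?_ 2)
  unfold sCirc
  have hc : ∀ e : ZdEdge d, Continuous fun s : Free pin a n → ℝ => glue a n θ s e := fun e => by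
    unfold glue; split_ifs
    · exact continuous_const
    · exact continuous_apply _
    · exact continuous_const
  exact (((hc _).add (hc _)).sub (hc _)).sub (hc _)

/-- The weight is measurable. [folklore] -/
theorem measurable_wθ (θ : ZdEdge d → ℝ) : Measurable (wθ pin a n θ) := by
  unfold wθ
  refine ENNReal.measurable_ofReal.comp (Real.measurable_exp.comp ?_)
  exact (((continuous_formM θ).comp (PiLp.continuous_ofLp 2 _)).measurable.neg).div_const _

/-- `‖λ_p‖ ≤ 4`. [folklore] -/
theorem norm_coeff_le (p : Plaq d) : ‖(WithLp.toLp 2 (coeff pin a n p) : EuclideanSpace ℝ (Free pin a n))‖ ≤ 4 := by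
  classical
  have hsq : ‖(WithLp.toLp 2 (coeff pin a n p) : EuclideanSpace ℝ (Free pin a n))‖ ^ 2 ≤ 16 := by
    rw [norm_toLp_sq]
    -- the support of `coeff p` maps injectively into the four edges of `p`
    set S : Finset (ZdEdge d) := {(p.1, p.2.1), (p.1 + Pi.single p.2.1 1, p.2.2), (p.1 + Pi.single p.2.2 1, p.2.1), (p.1, p.2.2)} with hS
    set T := (univ : Finset (Free pin a n)).filter fun e => e.1.1 ∈ S with hT
    have hzero : ∀ e : Free pin a n, e ∉ T → coeff pin a n p e = 0 := fun e he => by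
      apply coeffAux_eq_zero
      intro h
      apply he
      rw [hT, mem_filter]
      refine ⟨mem_univ _, ?_⟩
      rw [hS]
      simp only [mem_insert, mem_singleton]
      rcases h with h | h | h | h <;> simp [← h]
    have hTcard : #T ≤ 4 := by
      have hinj : Set.InjOn (fun e : Free pin a n => e.1.1) T := fun a _ b _ h => Subtype.ext (Subtype.ext h)
      rw [← card_image_of_injOn hinj]
      have hsub : T.image (fun e : Free pin a n => e.1.1) ⊆ S := fun e' he' => by
        obtain ⟨e, he, rfl⟩ := mem_image.1 he'
        exact (mem_filter.1 he).2
      refine (card_le_card hsub).trans ?_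
      rw [hS]
      exact (card_insert_le _ _).trans (Nat.succ_le_succ ((card_insert_le _ _).trans
        (Nat.succ_le_succ ((card_insert_le _ _).trans (Nat.succ_le_succ (card_singleton _).le)))))
    calc ∑ e, coeff pin a n p e ^ 2 = ∑ e ∈ T, coeff pin a n p e ^ 2 := by
          rw [← Finset.sum_subset (subset_univ T) (fun e _ he => by rw [hzero e he]; ring)]
      _ ≤ ∑ _e ∈ T, (4 : ℝ) := Finset.sum_le_sum fun e _ => by
          have := abs_coeffAux_le e.1.1 p
          rw [coeff, ← sq_abs]; nlinarith [abs_nonneg (coeffAux e.1.1 p)]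
      _ = #T * 4 := by rw [Finset.sum_const, nsmul_eq_mul]
      _ ≤ 4 * 4 := by gcongr; exact_mod_cast hTcard
      _ = 16 := by norm_num
  have h4 : (16 : ℝ) = 4 ^ 2 := by norm_num
  rw [h4] at hsq
  exact abs_le_of_sq_le_sq' hsq (by norm_num) |>.2 |> fun h => le_trans (le_abs_self _) (by
    rw [abs_of_nonneg (norm_nonneg _)]; exact h)

/-- `|b_p| ≤ 4η_b` when the pinned values on the box are bounded by `η_b`. [folklore] -/
theorem abs_bterm_le {θ : ZdEdge d → ℝ} {ηb : ℝ} (hηb : 0 ≤ ηb)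
    (hθ : ∀ e ∈ boxEdgesAt a n, pin e → |θ e| ≤ ηb) (p : Plaq d) : |bterm pin a n θ p| ≤ 4 * ηb := by
  have hg : ∀ e : ZdEdge d, |glue a n θ (0 : Free pin a n → ℝ) e| ≤ ηb := fun e => by
    by_cases h : e ∈ boxEdgesAt a n
    · by_cases hp : pin e
      · rw [glue_apply_pin _ _ h hp]; exact hθ e h hp
      · have : glue a n θ (0 : Free pin a n → ℝ) e = (0 : Free pin a n → ℝ) ⟨⟨e, h⟩, hp⟩ := glue_apply_free θ 0 ⟨⟨e, h⟩, hp⟩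
        rw [this, Pi.zero_apply, abs_zero]; exact hηb
    · rw [glue_apply_of_not_mem _ _ h, abs_zero]; exact hηb
  unfold bterm sCirc
  have h1 := hg (p.1, p.2.1); have h2 := hg (p.1 + Pi.single p.2.1 1, p.2.2)
  have h3 := hg (p.1 + Pi.single p.2.2 1, p.2.1); have h4 := hg (p.1, p.2.2)
  calc _ ≤ |glue a n θ (0 : Free pin a n → ℝ) (p.1, p.2.1) + glue a n θ 0 (p.1 + Pi.single p.2.1 1, p.2.2) -
          glue a n θ 0 (p.1 + Pi.single p.2.2 1, p.2.1)| + |glue a n θ (0 : Free pin a n → ℝ) (p.1, p.2.2)| := abs_sub _ _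
    _ ≤ (|glue a n θ (0 : Free pin a n → ℝ) (p.1, p.2.1) + glue a n θ 0 (p.1 + Pi.single p.2.1 1, p.2.2)| +
          |glue a n θ (0 : Free pin a n → ℝ) (p.1 + Pi.single p.2.2 1, p.2.1)|) + |glue a n θ (0 : Free pin a n → ℝ) (p.1, p.2.2)| := by
        gcongr; exact abs_sub _ _
    _ ≤ ((|glue a n θ (0 : Free pin a n → ℝ) (p.1, p.2.1)| + |glue a n θ (0 : Free pin a n → ℝ) (p.1 + Pi.single p.2.1 1, p.2.2)|) +
          |glue a n θ (0 : Free pin a n → ℝ) (p.1 + Pi.single p.2.2 1, p.2.1)|) + |glue a n θ (0 : Free pin a n → ℝ) (p.1, p.2.2)| := by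
        gcongr; exact abs_add_le _ _
    _ ≤ ((ηb + ηb) + ηb) + ηb := by gcongr
    _ = 4 * ηb := by ring

/-- **Mean bound**: `‖μ_θ‖ ≤ 16 |B_n'| η_b / c_n` (Chatterjee's `‖μ‖ ≤ C n^{d+2}‖θ‖`, in sup-norm form). [cite: arXiv160201222, Thm. 14.2 (proof)] -/
theorem norm_mean_le (hpin : ∀ e ∈ boxEdges d n, IsComb e → pin (shiftE a e)) {θ : ZdEdge d → ℝ} {ηb : ℝ} (hηb : 0 ≤ ηb)
    (hθ : ∀ e ∈ boxEdgesAt a n, pin e → |θ e| ≤ ηb) :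
    ‖(WithLp.toLp 2 (mean pin a n θ) : EuclideanSpace ℝ (Free pin a n))‖ ≤
      16 * #(plaquettesIn (halfOpenBox d n)) * ηb / cLow d n := by
  have hv : ‖(WithLp.toLp 2 (vvec pin a n θ) : EuclideanSpace ℝ (Free pin a n))‖ ≤ 16 * #(plaquettesIn (halfOpenBox d n)) * ηb := by
    rw [vvec, WithLp.toLp_sum]
    refine (norm_sum_le _ _).trans ?_
    calc ∑ p ∈ plaquettesIn (halfOpenBox d n), ‖WithLp.toLp 2 (bterm pin a n θ (Plaq.shift a p) • coeff pin a n (Plaq.shift a p))‖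
        ≤ ∑ _p ∈ plaquettesIn (halfOpenBox d n), 4 * ηb * 4 := Finset.sum_le_sum fun p _ => by
          rw [WithLp.toLp_smul, norm_smul, Real.norm_eq_abs]
          exact mul_le_mul (abs_bterm_le hηb hθ _) (norm_coeff_le _) (norm_nonneg _) (by positivity)
      _ = 16 * #(plaquettesIn (halfOpenBox d n)) * ηb := by rw [Finset.sum_const, nsmul_eq_mul]; ring
  rw [mean, WithLp.toLp_neg, norm_neg]
  refine (norm_inv_mulVec_le (posDef_Qmat hpin) cLow_pos (fun v => (form_bounds hpin v).1) _).trans ?_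
  exact div_le_div_of_nonneg_right hv cLow_pos.le

variable (pin a n) in
/-- The radius `R = 16|B_n'|η_b/c_n + (2 log(4|free| + 4)/c_n)^{1/2}` of Theorem 14.2 (printed as
`C n^{d+2}(1 + ‖θ‖)`). [cite: arXiv160201222, Thm. 14.2] -/
def Rθ (ηb : ℝ) : ℝ :=
  16 * #(plaquettesIn (halfOpenBox d n)) * ηb / cLow d n +
    Real.sqrt (2 * Real.log (4 * Fintype.card (Free pin a n) + 4) / cLow d n)

/-- **Theorem 14.2**: with the comb tree pinned and pinned values bounded by `η_b ≥ 0` on the box,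
the unnormalised Gaussian integral of `e^{-½M_θ}` over `{|s_e| ≤ R ∀ e}` is at least half of the
total: `τ_{E,θ,n}(|s_e| ≤ R ∀ e) ≥ 1/2`, `R = Rθ`. Proof as printed: complete the square
(`τ_{E,θ,n}` is `N(μ_θ, Q⁻¹)`), `‖μ_θ‖ ≤ 16|B_n'|η_b/c_n`, and the union bound `gaussmax`. [cite: arXiv160201222, Thm. 14.2] -/
theorem theorem_14_2 (hpin : ∀ e ∈ boxEdges d n, IsComb e → pin (shiftE a e)) {θ : ZdEdge d → ℝ} {ηb : ℝ} (hηb : 0 ≤ ηb)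
    (hθ : ∀ e ∈ boxEdgesAt a n, pin e → |θ e| ≤ ηb) :
    ∫⁻ s, wθ pin a n θ s ≤ 2 * ∫⁻ s in {s : EuclideanSpace ℝ (Free pin a n) | ∀ e, |s e| ≤ Rθ pin a n ηb}, wθ pin a n θ s := by
  obtain ⟨hτ, hZ0, hZtop⟩ := τ_eq_withDensity (pin := pin) (a := a) (n := n) hpin
  set Q := Qmat pin a n with hQ
  set m : EuclideanSpace ℝ (Free pin a n) := WithLp.toLp 2 (mean pin a n θ) with hm
  set K := ENNReal.ofReal (Real.exp (-(Kconst pin a n θ) / 2)) with hK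
  set E := {s : EuclideanSpace ℝ (Free pin a n) | ∀ e, |s e| ≤ Rθ pin a n ηb} with hE
  have hEm : MeasurableSet E := by
    have : E = ⋂ e, {s : EuclideanSpace ℝ (Free pin a n) | |s e| ≤ Rθ pin a n ηb} := by ext; simp [hE]
    rw [this]; exact MeasurableSet.iInter fun e => measurableSet_le (by fun_prop) measurable_const
  -- the withDensity measure `W = gW · vol = Z • τ`
  have hW : (volume : Measure (EuclideanSpace ℝ (Free pin a n))).withDensity (gaussWeight Q) = gaussZ Q • τ pin a n := by
    rw [hτ, smul_smul, ENNReal.mul_inv_cancel hZ0 hZtop, one_smul]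
  -- both integrals in terms of `τ`
  have hset : ∀ F : Set (EuclideanSpace ℝ (Free pin a n)), MeasurableSet F →
      ∫⁻ s in F, wθ pin a n θ s = K * (gaussZ Q * τ pin a n ((fun u => u + m) ⁻¹' F)) := by
    intro F hF
    have h1 : ∫⁻ s in F, wθ pin a n θ s = ∫⁻ s, F.indicator (wθ pin a n θ) s := (lintegral_indicator hF _).symm
    rw [h1]
    have h2 : (fun s => F.indicator (wθ pin a n θ) s) = fun s => K * F.indicator (fun s => gaussWeight Q (s - m)) s := by
      funext s
      by_cases hs : s ∈ F
      · rw [Set.indicator_of_mem hs, Set.indicator_of_mem hs, wθ_eq hpin]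
      · rw [Set.indicator_of_notMem hs, Set.indicator_of_notMem hs, mul_zero]
    have hmeas : Measurable fun s : EuclideanSpace ℝ (Free pin a n) => gaussWeight Q (s - m) :=
      (measurable_gaussWeight Q).comp (measurable_sub_const m)
    rw [h2, lintegral_const_mul _ (hmeas.indicator hF)]
    congr 1
    -- translate `s = u + m`
    have h3 : ∫⁻ s, F.indicator (fun s => gaussWeight Q (s - m)) s =
        ∫⁻ u, F.indicator (fun s => gaussWeight Q (s - m)) (u + m) := (lintegral_add_right_eq_self _ m).symm
    rw [h3]
    have h4 : (fun u => F.indicator (fun s => gaussWeight Q (s - m)) (u + m)) =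
        fun u => ((fun u => u + m) ⁻¹' F).indicator (gaussWeight Q) u := by
      funext u
      by_cases hu : u + m ∈ F
      · rw [Set.indicator_of_mem hu, Set.indicator_of_mem (show u ∈ (fun u => u + m) ⁻¹' F from hu),
          add_sub_cancel_right]
      · rw [Set.indicator_of_notMem hu, Set.indicator_of_notMem (show u ∉ (fun u => u + m) ⁻¹' F from hu)]
    rw [h4, lintegral_indicator (measurable_add_const m hF), ← withDensity_apply _ (measurable_add_const m hF), hW,
      Measure.smul_apply, smul_eq_mul]
  rw [← setLIntegral_univ (wθ pin a n θ), hset Set.univ MeasurableSet.univ, hset E hEm, Set.preimage_univ, measure_univ, mul_one]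
  -- `τ ((· + m)⁻¹ E) ≥ 1/2`
  set x := Real.sqrt (2 * Real.log (4 * Fintype.card (Free pin a n) + 4) / cLow d n) with hxdef
  have hx : 0 ≤ x := Real.sqrt_nonneg _
  have hprob := multivariateGaussian_real_forall_abs_add_le_ge (posDef_Qmat hpin) cLow_pos
    (fun v => (form_bounds hpin v).1) (fun v => (form_bounds hpin v).2) m hx
  have hk : (0 : ℝ) ≤ Fintype.card (Free pin a n) := Nat.cast_nonneg _
  have hexp : 2 * (Fintype.card (Free pin a n) : ℝ) * Real.exp (-(cLow d n * x ^ 2 / 2)) ≤ 1 / 2 := by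
    have hc := cLow_pos (d := d) (n := n)
    have hlog : cLow d n * x ^ 2 / 2 = Real.log (4 * Fintype.card (Free pin a n) + 4) := by
      rw [hxdef, Real.sq_sqrt (div_nonneg (mul_nonneg two_pos.le (Real.log_nonneg (by linarith))) hc.le)]
      field_simp
    rw [hlog, Real.exp_neg, Real.exp_log (by linarith), ← div_eq_mul_inv,
      div_le_div_iff₀ (by linarith) (by norm_num : (0 : ℝ) < 2)]
    nlinarith
  have hsub : {s : EuclideanSpace ℝ (Free pin a n) | ∀ i, |s i + m i| ≤ ‖m‖ + x} ⊆ (fun u => u + m) ⁻¹' E := by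
    intro s hs
    simp only [Set.mem_preimage, hE, Set.mem_setOf_eq, PiLp.add_apply]
    intro e
    refine (hs e).trans ?_
    unfold Rθ
    rw [← hxdef]
    gcongr
    rw [hm]; exact norm_mean_le hpin hηb hθ
  have hhalf : (1 / 2 : ℝ) ≤ (τ pin a n).real ((fun u => u + m) ⁻¹' E) :=
    calc (1 / 2 : ℝ) ≤ 1 - 2 * Fintype.card (Free pin a n) * Real.exp (-(cLow d n * x ^ 2 / 2)) := by linarith
      _ ≤ _ := hprob
      _ ≤ (τ pin a n).real ((fun u => u + m) ⁻¹' E) := measureReal_mono hsub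
  have hhalf' : (2 : ℝ≥0∞)⁻¹ ≤ τ pin a n ((fun u => u + m) ⁻¹' E) := by
    rw [← ENNReal.ofReal_toReal (measure_ne_top (τ pin a n) _), ← measureReal_def]
    rw [show (2 : ℝ≥0∞)⁻¹ = ENNReal.ofReal (1 / 2) by rw [one_div, ENNReal.ofReal_inv_of_pos two_pos]; norm_num]
    exact ENNReal.ofReal_le_ofReal hhalf
  calc K * gaussZ Q = K * gaussZ Q * (2 * (2 : ℝ≥0∞)⁻¹) := by rw [ENNReal.mul_inv_cancel two_ne_zero ENNReal.ofNat_ne_top, mul_one]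
    _ = 2 * (K * (gaussZ Q * (2 : ℝ≥0∞)⁻¹)) := by ring
    _ ≤ 2 * (K * (gaussZ Q * τ pin a n ((fun u => u + m) ⁻¹' E))) := by gcongr

end Theorem142

/-! ### Blocks for the multiscale argument of Theorem 14.3 -/

section Blocks

variable (m : ℕ)

/-- The block step `M = m - 1` (as an integer). [cite: arXiv160201222, Thm. 14.3 (proof)] -/
def bM : ℤ := (m : ℤ) - 1

/-- A vertex touches the block grid: some coordinate is a multiple of `m - 1` ("at least one
endpoint in the boundary of some `x + B_m`"). [cite: arXiv160201222, Thm. 14.3 (proof)] -/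
def Touch (x : ZSite d) : Prop := ∃ k, bM m ∣ x k

/-- `Touch` is decidable. [folklore] -/
instance (x : ZSite d) : Decidable (Touch m x) := by unfold Touch; infer_instance

/-- The boundary edges `A`: an endpoint touches the grid. [cite: arXiv160201222, Thm. 14.3 (proof), the set `A`] -/
def IsBdry (e : ZdEdge d) : Prop := Touch m e.1 ∨ Touch m (e.1 + Pi.single e.2 1)

/-- `IsBdry` is decidable. [folklore] -/
instance (e : ZdEdge d) : Decidable (IsBdry m e) := by unfold IsBdry; infer_instance

/-- The block index of a vertex. [cite: arXiv160201222, Thm. 14.3 (proof)] -/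
def blk (x : ZSite d) : Fin d → ℤ := fun k => x k / bM m

/-- The corner `(m-1)·b` of block `b`. [cite: arXiv160201222, Thm. 14.3 (proof), `𝒟`] -/
def corner (b : Fin d → ℤ) : ZSite d := fun k => b k * bM m

variable {m}

/-- A non-touching coordinate lies strictly inside its block interval. [folklore] -/
theorem strict_of_not_dvd (hm : 2 ≤ m) {x : ℤ} (hx : ¬ bM m ∣ x) :
    x / bM m * bM m < x ∧ x < x / bM m * bM m + bM m := by
  have hM : 0 < bM m := by unfold bM; omega
  have h1 := Int.emod_add_mul_ediv x (bM m)
  have h2 := Int.emod_nonneg x hM.ne'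
  have h3 := Int.emod_lt_of_pos x hM
  have h4 : x % bM m ≠ 0 := fun h => hx (Int.dvd_of_emod_eq_zero h)
  have h5 : bM m * (x / bM m) = x / bM m * bM m := mul_comm _ _
  constructor
  · have : 0 < x % bM m := lt_of_le_of_ne h2 (Ne.symm h4)
    linarith
  · linarith

/-- If neither `x` nor `x + 1` is a multiple of `M`, they have the same quotient. [folklore] -/
theorem ediv_add_one_eq (hm : 2 ≤ m) {x : ℤ} (hx : ¬ bM m ∣ x) (hx1 : ¬ bM m ∣ (x + 1)) :
    (x + 1) / bM m = x / bM m := by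
  have hM : 0 < bM m := by unfold bM; omega
  obtain ⟨h1, h2⟩ := strict_of_not_dvd hm hx
  obtain ⟨h3, h4⟩ := strict_of_not_dvd hm hx1
  -- `q M < x < x+1 < q' M + M` and `q' M < x + 1`, so `q = q'`
  set q := x / bM m
  set q' := (x + 1) / bM m
  have h5 : q' * bM m < (q + 1) * bM m := by nlinarith
  have h6 : q * bM m < (q' + 1) * bM m := by nlinarith
  have h7 : q' < q + 1 := lt_of_mul_lt_mul_right h5 hM.le
  have h8 : q < q' + 1 := lt_of_mul_lt_mul_right h6 hM.le
  omega

variable (m) in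
/-- The closed block of `b`: `corner_k ≤ y_k ≤ corner_k + (m-1)` for all `k`. [cite: arXiv160201222, Thm. 14.3 (proof)] -/
def InBlock (b : Fin d → ℤ) (y : ZSite d) : Prop := ∀ k, corner m b k ≤ y k ∧ y k ≤ corner m b k + bM m

/-- The closed block is the translated vertex box `corner + B_m`. [folklore] -/
theorem inBlock_iff_sub_mem {b : Fin d → ℤ} {y : ZSite d} :
    InBlock m b y ↔ y - corner m b ∈ halfOpenBox d m := by
  rw [mem_halfOpenBox]
  simp only [InBlock, Pi.sub_apply, bM]
  constructor
  · intro h k; have := h k; constructor <;> omega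
  · intro h k; have := h k; constructor <;> omega

/-- A non-touching vertex lies strictly inside the block `blk x`. [folklore] -/
theorem strict_of_not_touch (hm : 2 ≤ m) {x : ZSite d} (hx : ¬ Touch m x) (k : Fin d) :
    corner m (blk m x) k < x k ∧ x k < corner m (blk m x) k + bM m := by
  have hk : ¬ bM m ∣ x k := fun h => hx ⟨k, h⟩
  exact strict_of_not_dvd hm hk

/-- For an interior (non-boundary) edge, the endpoint `x + e_i` has the same block index as `x`. [folklore] -/
theorem blk_add_single (hm : 2 ≤ m) {e : ZdEdge d} (he : ¬ IsBdry m e) :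
    blk m (e.1 + Pi.single e.2 1) = blk m e.1 := by
  simp only [IsBdry, not_or] at he
  obtain ⟨h1, h2⟩ := he
  funext k
  simp only [blk]
  by_cases hk : k = e.2
  · rw [hk]
    simp only [Pi.add_apply, Pi.single_eq_same]
    refine ediv_add_one_eq hm (fun h => h1 ⟨e.2, h⟩) (fun h => h2 ⟨e.2, ?_⟩)
    simpa using h
  · simp [Pi.single_eq_of_ne hk]

/-- Both endpoints of an interior edge lie strictly inside the block of its source. [folklore] -/
theorem strict_endpoints (hm : 2 ≤ m) {e : ZdEdge d} (he : ¬ IsBdry m e) (k : Fin d) :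
    (corner m (blk m e.1) k < e.1 k ∧ e.1 k < corner m (blk m e.1) k + bM m) ∧
      (corner m (blk m e.1) k < (e.1 + Pi.single e.2 1 : ZSite d) k ∧
        (e.1 + Pi.single e.2 1 : ZSite d) k < corner m (blk m e.1) k + bM m) := by
  have he' := he
  simp only [IsBdry, not_or] at he'
  refine ⟨strict_of_not_touch hm he'.1 k, ?_⟩
  have := strict_of_not_touch hm he'.2 k
  rwa [blk_add_single hm he] at this

/-- A vertex within sup-distance one "outward by a unit vector" of a strictly interior vertex is in
the closed block: the cases `v = w`, `v = w + e_l`, `v = w - e_l`. [folklore] -/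
theorem inBlock_of_strict {b : Fin d → ℤ} {w : ZSite d}
    (hw : ∀ k, corner m b k < w k ∧ w k < corner m b k + bM m) :
    InBlock m b w ∧ (∀ l, InBlock m b (w + Pi.single l 1)) ∧ (∀ l, InBlock m b (w - Pi.single l 1)) := by
  refine ⟨fun k => ⟨(hw k).1.le, by linarith [(hw k).2]⟩, fun l k => ?_, fun l k => ?_⟩
  · by_cases hk : k = l
    · subst hk; simp; constructor <;> linarith [(hw k).1, (hw k).2]
    · simp [Pi.single_eq_of_ne hk]; exact ⟨(hw k).1.le, by linarith [(hw k).2]⟩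
  · by_cases hk : k = l
    · subst hk; simp; constructor <;> linarith [(hw k).1, (hw k).2]
    · simp [Pi.single_eq_of_ne hk]; exact ⟨(hw k).1.le, by linarith [(hw k).2]⟩

/-- **Plaquettes touching the interior of a block lie in the block**: if one of the four edges of
the plaquette `q` is an interior edge with source block `b`, all four vertices of `q` are in the
closed block `b`, i.e. `q` is a translate of a plaquette of `B_m`. [cite: arXiv160201222, Thm. 14.3 (proof)] -/
theorem shift_mem_of_touch (hm : 2 ≤ m) {q : Plaq d} (hq : q.2.1 < q.2.2) {e : ZdEdge d} (he : ¬ IsBdry m e)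
    (hqe : (q.1, q.2.1) = e ∨ (q.1 + Pi.single q.2.1 1, q.2.2) = e ∨
      (q.1 + Pi.single q.2.2 1, q.2.1) = e ∨ (q.1, q.2.2) = e) :
    (q.1 - corner m (blk m e.1), q.2) ∈ plaquettesIn (halfOpenBox d m) := by
  set b := blk m e.1 with hb
  have hsrc := fun k => (strict_endpoints hm he k).1
  have htgt := fun k => (strict_endpoints hm he k).2
  obtain ⟨hs0, hs1, hs2⟩ := inBlock_of_strict (m := m) hsrc
  obtain ⟨ht0, ht1, ht2⟩ := inBlock_of_strict (m := m) htgt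
  -- the four vertices of `q`
  have hv : InBlock m b q.1 ∧ InBlock m b (q.1 + Pi.single q.2.1 1) ∧ InBlock m b (q.1 + Pi.single q.2.2 1) ∧
      InBlock m b (q.1 + Pi.single q.2.1 1 + Pi.single q.2.2 1) := by
    rcases hqe with h | h | h | h
    · -- `e = (y, i)`: `x = y`, `x + e_i = y + e_i`
      have hy : q.1 = e.1 := congr_arg Prod.fst h
      have hi : q.2.1 = e.2 := congr_arg Prod.snd h
      rw [hy, hi]
      exact ⟨hs0, ht0, hs1 _, ht1 _⟩
    · -- `e = (y + e_i, j)`: `x = y + e_i`, `x + e_j = y + e_i + e_j`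
      have hy : q.1 + Pi.single q.2.1 1 = e.1 := congr_arg Prod.fst h
      have hj : q.2.2 = e.2 := congr_arg Prod.snd h
      have hy' : q.1 = e.1 - Pi.single q.2.1 1 := by rw [← hy]; simp
      refine ⟨hy' ▸ hs2 _, hy ▸ hs0, ?_, ?_⟩
      · have : q.1 + Pi.single q.2.2 1 = (e.1 + Pi.single e.2 1) - Pi.single q.2.1 1 := by rw [← hy, ← hj]; abel
        rw [this]; exact ht2 _
      · rw [hy, hj]; exact ht0
    · -- `e = (y + e_j, i)`
      have hy : q.1 + Pi.single q.2.2 1 = e.1 := congr_arg Prod.fst h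
      have hi : q.2.1 = e.2 := congr_arg Prod.snd h
      have hy' : q.1 = e.1 - Pi.single q.2.2 1 := by rw [← hy]; simp
      refine ⟨hy' ▸ hs2 _, ?_, hy ▸ hs0, ?_⟩
      · have : q.1 + Pi.single q.2.1 1 = (e.1 + Pi.single e.2 1) - Pi.single q.2.2 1 := by rw [← hy, ← hi]; abel
        rw [this]; exact ht2 _
      · rw [add_right_comm, hy, hi]; exact ht0
    · -- `e = (y, j)`
      have hy : q.1 = e.1 := congr_arg Prod.fst h
      have hj : q.2.2 = e.2 := congr_arg Prod.snd h
      rw [hy, hj]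
      refine ⟨hs0, hs1 _, ht0, ?_⟩
      rw [add_right_comm]; exact ht1 _
  obtain ⟨h1, h2, h3, h4⟩ := hv
  rw [Plaq.mem_plaquettesIn]
  refine ⟨inBlock_iff_sub_mem.1 h1, hq, ?_, ?_, ?_⟩
  · rw [sub_add_eq_add_sub]; exact inBlock_iff_sub_mem.1 h2
  · rw [sub_add_eq_add_sub]; exact inBlock_iff_sub_mem.1 h3
  · rw [sub_add_eq_add_sub, sub_add_eq_add_sub]; exact inBlock_iff_sub_mem.1 h4

/-- An interior edge with source block `b` is an edge of the block `corner b + B_m`. [folklore] -/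
theorem mem_boxEdgesAt_of_not_isBdry (hm : 2 ≤ m) {e : ZdEdge d} (he : ¬ IsBdry m e) :
    e ∈ boxEdgesAt (corner m (blk m e.1)) m := by
  rw [mem_boxEdgesAt, mem_boxEdges]
  have hsrc := fun k => (strict_endpoints hm he k).1
  have htgt := fun k => (strict_endpoints hm he k).2
  obtain ⟨hs0, -, -⟩ := inBlock_of_strict (m := m) hsrc
  obtain ⟨ht0, -, -⟩ := inBlock_of_strict (m := m) htgt
  refine ⟨inBlock_iff_sub_mem.1 hs0, ?_⟩
  rw [sub_add_eq_add_sub]; exact inBlock_iff_sub_mem.1 ht0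

variable {r : ℕ}

variable (m r) in
/-- The fine side length `n = r(m-1) + 1`. [cite: arXiv160201222, Thm. 14.3 (proof), "`n - 1 = r(m-1)`"] -/
def fineN : ℕ := r * (m - 1) + 1

/-- Vertices of a valid closed block lie in the fine box `B_n`. [folklore] -/
theorem mem_halfOpenBox_of_inBlock (hm : 1 ≤ m) {b : Fin d → ℤ} (hb : ∀ k, 0 ≤ b k ∧ b k < r) {y : ZSite d}
    (hy : InBlock m b y) : y ∈ halfOpenBox d (fineN m r) := by
  rw [mem_halfOpenBox]
  intro k
  obtain ⟨h1, h2⟩ := hy k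
  obtain ⟨hb0, hbr⟩ := hb k
  simp only [corner, bM, fineN] at h1 h2 ⊢
  have hM : (0 : ℤ) ≤ (m : ℤ) - 1 := by omega
  push_cast
  have hm' : ((m - 1 : ℕ) : ℤ) = (m : ℤ) - 1 := by omega
  rw [hm']
  constructor
  · nlinarith
  · have : (b k + 1) * ((m : ℤ) - 1) ≤ (r : ℤ) * ((m : ℤ) - 1) := by
      apply mul_le_mul_of_nonneg_right _ hM; omega
    nlinarith

/-- **Block plaquettes are plaquettes of the fine box** (valid blocks). [folklore] -/
theorem shift_mem_plaquettesIn_fine (hm : 1 ≤ m) {b : Fin d → ℤ} (hb : ∀ k, 0 ≤ b k ∧ b k < r) {p : Plaq d}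
    (hp : p ∈ plaquettesIn (halfOpenBox d m)) : Plaq.shift (corner m b) p ∈ plaquettesIn (halfOpenBox d (fineN m r)) := by
  rw [Plaq.mem_plaquettesIn] at hp ⊢
  obtain ⟨h1, hlt, h2, h3, h4⟩ := hp
  have hin : ∀ y : ZSite d, y ∈ halfOpenBox d m → InBlock m b (y + corner m b) := fun y hy =>
    inBlock_iff_sub_mem.2 (by simpa using hy)
  simp only [Plaq.shift_fst, Plaq.shift_snd]
  refine ⟨mem_halfOpenBox_of_inBlock hm hb (hin _ h1), hlt, ?_, ?_, ?_⟩
  · rw [add_right_comm]; exact mem_halfOpenBox_of_inBlock hm hb (hin _ h2)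
  · rw [add_right_comm]; exact mem_halfOpenBox_of_inBlock hm hb (hin _ h3)
  · rw [add_right_comm p.1 (corner m b) (Pi.single p.2.1 1),
      add_right_comm (p.1 + Pi.single p.2.1 1) (corner m b) (Pi.single p.2.2 1)]
    exact mem_halfOpenBox_of_inBlock hm hb (hin _ h4)

/-- **Block edges are edges of the fine box** (valid blocks). [folklore] -/
theorem boxEdgesAt_subset (hm : 1 ≤ m) {b : Fin d → ℤ} (hb : ∀ k, 0 ≤ b k ∧ b k < r) :
    boxEdgesAt (corner m b) m ⊆ boxEdges d (fineN m r) := by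
  intro e he
  rw [mem_boxEdgesAt, mem_boxEdges] at he
  rw [mem_boxEdges]
  have hin : ∀ y : ZSite d, y - corner m b ∈ halfOpenBox d m → InBlock m b y := fun y hy =>
    inBlock_iff_sub_mem.2 hy
  refine ⟨mem_halfOpenBox_of_inBlock hm hb (hin _ he.1), mem_halfOpenBox_of_inBlock hm hb (hin _ ?_)⟩
  rw [← sub_add_eq_add_sub]; exact he.2

/-- **The comb tree of a block is pinned**: a comb edge of the block `b` (relative to its corner)
is either a comb edge of the fine box or a boundary edge, hence never an interior free edge. [cite: arXiv160201222, Thm. 14.3 (proof)] -/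
theorem isComb_or_isBdry_of_isComb {b : Fin d → ℤ} {e : ZdEdge d} (he : IsComb e) :
    IsComb (shiftE (corner m b) e) ∨ IsBdry m (shiftE (corner m b) e) := by
  by_cases hlast : ∀ k : Fin d, ¬ e.2 < k
  · left
    intro k hk; exact absurd hk (hlast k)
  · right
    push Not at hlast
    obtain ⟨k, hk⟩ := hlast
    left
    refine ⟨k, ?_⟩
    simp only [shiftE_apply, Pi.add_apply, he k hk, zero_add, corner]
    exact Dvd.intro_left _ rfl

end Blocks

/-! ### Theorem 14.3, combinatorial part: the fine box, its blocks, and the form decomposition -/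

section Multiscale

/-- The pinned set of the fine box: the comb tree `E_n^0`. [cite: arXiv160201222, §13] -/
def pinI : ZdEdge d → Prop := fun e => IsComb e

/-- `pinI` is decidable. [folklore] -/
instance : DecidablePred (pinI (d := d)) := fun e => by unfold pinI; infer_instance

/-- The comb tree is pinned by `pinI` (corner `0`). [folklore] -/
theorem hpinI (n : ℕ) : ∀ e ∈ boxEdges d n, IsComb e → pinI (shiftE (0 : ZSite d) e) := by
  intro e _ he
  simpa [pinI] using he

/-- `boxEdgesAt 0 n = boxEdges d n` (membership). [folklore] -/
theorem mem_boxEdgesAt_zero {n : ℕ} {e : ZdEdge d} : e ∈ boxEdgesAt (0 : ZSite d) n ↔ e ∈ boxEdges d n := by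
  rw [mem_boxEdgesAt]; simp

/-- `Plaq.shift 0 = id`. [folklore] -/
@[simp] theorem shift_zero (p : Plaq d) : Plaq.shift (0 : ZSite d) p = p := by
  ext <;> simp [Plaq.shift]

variable (m r : ℕ)

/-- The free edges of the fine box `B_n`, `n = r(m-1)+1` (the index set of `τ_n`). [cite: arXiv160201222, Thm. 14.3] -/
abbrev Amb : Type := Free (pinI (d := d)) (0 : ZSite d) (fineN m r)

variable {m r}

variable (m) in
/-- The pinned predicate of block `b` inside the fine box: everything except the free interior
edges of `b`. [cite: arXiv160201222, Thm. 14.3 (proof)] -/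
def pinB (b : Fin d → ℤ) : ZdEdge d → Prop := fun e => IsComb e ∨ IsBdry m e ∨ blk m e.1 ≠ b

/-- `pinB` is decidable. [folklore] -/
instance (b : Fin d → ℤ) : DecidablePred (pinB (d := d) m b) := fun e => by unfold pinB; infer_instance

/-- The comb tree of a block is pinned in `pinB`. [cite: arXiv160201222, Thm. 14.3 (proof)] -/
theorem hpinB (b : Fin d → ℤ) : ∀ e ∈ boxEdges d m, IsComb e → pinB m b (shiftE (corner m b) e) := by
  intro e _ he
  rcases isComb_or_isBdry_of_isComb (m := m) (b := b) he with h | h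
  · exact Or.inl h
  · exact Or.inr (Or.inl h)

variable (m) in
/-- The interior free edges of block `b`, as a predicate on the ambient index. [cite: arXiv160201222, Thm. 14.3 (proof)] -/
def Pb (b : Fin d → ℤ) (i : Amb (d := d) m r) : Prop := ¬ IsBdry m i.1.1 ∧ blk m i.1.1.1 = b

/-- `Pb` is decidable. [folklore] -/
instance (b : Fin d → ℤ) : DecidablePred (Pb (d := d) (r := r) m b) := fun i => by unfold Pb; infer_instance

/-- A non-boundary edge of the closed block `b` has source block `b`. [folklore] -/
theorem blk_eq_of_mem_of_not_isBdry (hm : 2 ≤ m) {b : Fin d → ℤ} {e : ZdEdge d}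
    (he : e ∈ boxEdgesAt (corner m b) m) (hnb : ¬ IsBdry m e) : blk m e.1 = b := by
  have hM : 0 < bM m := by unfold bM; omega
  rw [mem_boxEdgesAt, mem_boxEdges] at he
  have h1 := he.1
  rw [mem_halfOpenBox] at h1
  funext k
  have hs := (strict_endpoints hm hnb k).1
  have hk := h1 k
  simp only [Pi.sub_apply, corner] at hk hs
  -- `b_k M ≤ x_k < b_k M + m` and `q M < x_k < q M + M` with `q = blk`, `M = m - 1`
  set q := blk m e.1 k
  have hbM : bM m = (m : ℤ) - 1 := rfl
  have h2 : q * bM m < (b k + 1) * bM m := by nlinarith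
  have h3 : b k * bM m < (q + 1) * bM m := by nlinarith
  have h4 := lt_of_mul_lt_mul_right h2 hM.le
  have h5 := lt_of_mul_lt_mul_right h3 hM.le
  omega

/-- **The index equivalence** between the interior free edges of block `b` (ambient indices) and
the free edges of the block `corner b + B_m` pinned by `pinB`. [folklore] -/
def eqv (hm : 2 ≤ m) {b : Fin d → ℤ} (hb : ∀ k, 0 ≤ b k ∧ b k < r) :
    {i : Amb (d := d) m r // Pb m b i} ≃ Free (pinB m b) (corner m b) m where
  toFun i := ⟨⟨i.1.1.1, by
      have h := mem_boxEdgesAt_of_not_isBdry hm i.2.1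
      rwa [i.2.2] at h⟩, by
      simp only [pinB, not_or, not_not]
      exact ⟨i.1.2, i.2.1, i.2.2⟩⟩
  invFun e := ⟨⟨⟨e.1.1, by
      rw [mem_boxEdgesAt_zero]
      exact boxEdgesAt_subset (by omega) hb e.1.2⟩, by
      have h := e.2; simp only [pinB, not_or] at h; exact h.1⟩, by
      have h := e.2; simp only [pinB, not_or, not_not] at h; exact ⟨h.2.1, h.2.2⟩⟩
  left_inv i := by rfl
  right_inv e := by rfl

/-- The ambient edge function `t̂ = glue 0 t` (comb edges `0`). [cite: arXiv160201222, §13] -/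
abbrev ambE (t : Amb (d := d) m r → ℝ) : ZdEdge d → ℝ := glue (pin := pinI) (0 : ZSite d) (fineN m r) 0 t

/-- The plaquette cost of the ambient configuration. [folklore] -/
abbrev cq (t : Amb (d := d) m r → ℝ) (q : Plaq d) : ℝ := (sCirc (ambE t) q) ^ 2

/-- The ambient form is the sum of plaquette costs over `B_n'`. [cite: arXiv160201222, §13] -/
theorem formM_amb (t : Amb (d := d) m r → ℝ) :
    formM pinI (0 : ZSite d) (fineN m r) 0 t = ∑ q ∈ plaquettesIn (halfOpenBox d (fineN m r)), cq t q := by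
  simp [formM, cq, ambE]

/-- The block values of an ambient configuration. [folklore] -/
def tB (hm : 2 ≤ m) {b : Fin d → ℤ} (hb : ∀ k, 0 ≤ b k ∧ b k < r) (t : Amb (d := d) m r → ℝ) :
    Free (pinB m b) (corner m b) m → ℝ := fun e => t ((eqv hm hb).symm e).1

/-- **Glue agreement**: on the edges of block `b`, the block configuration glued from the ambient
values `θ = t̂'` on pinned edges and the interior values of `t` agrees with `t̂`, provided `t̂'`
and `t̂` agree off the interior of `b`. [folklore] -/
theorem glue_block_eq (hm : 2 ≤ m) {b : Fin d → ℤ} (hb : ∀ k, 0 ≤ b k ∧ b k < r) (t t' : Amb (d := d) m r → ℝ)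
    (htt' : ∀ i, ¬ Pb m b i → t i = t' i) {e : ZdEdge d} (he : e ∈ boxEdgesAt (corner m b) m) :
    glue (corner m b) m (ambE t') (tB hm hb t) e = ambE t e := by
  by_cases hp : pinB m b e
  · rw [glue_apply_pin _ _ he hp]
    -- pinned block edge: ambient values of `t` and `t'` agree there
    have heA : e ∈ boxEdgesAt (0 : ZSite d) (fineN m r) := by
      rw [mem_boxEdgesAt_zero]; exact boxEdgesAt_subset (by omega) hb he
    by_cases hc : pinI e
    · simp [ambE, glue_apply_pin _ _ heA hc]
    · have h1 : ambE t' e = t' ⟨⟨e, heA⟩, hc⟩ := glue_apply_free _ _ ⟨⟨e, heA⟩, hc⟩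
      have h2 : ambE t e = t ⟨⟨e, heA⟩, hc⟩ := glue_apply_free _ _ ⟨⟨e, heA⟩, hc⟩
      rw [h1, h2, htt']
      intro hP
      -- `e` free, pinned in the block, interior: impossible
      simp only [pinB] at hp
      rcases hp with h | h | h
      · exact hc h
      · exact hP.1 h
      · exact h hP.2
  · have h1 : glue (corner m b) m (ambE t') (tB hm hb t) e = tB hm hb t ⟨⟨e, he⟩, hp⟩ :=
      glue_apply_free _ _ ⟨⟨e, he⟩, hp⟩
    rw [h1, tB]
    set i := (eqv hm hb).symm ⟨⟨e, he⟩, hp⟩ with hi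
    have h2 : ambE t i.1.1.1 = t i.1 := glue_apply_free _ _ i.1
    have h3 : i.1.1.1 = e := rfl
    rw [h3] at h2
    exact h2.symm

/-- The block form of the transported configuration is the sum of the ambient plaquette costs over
the plaquettes of the block. [cite: arXiv160201222, Thm. 14.3 (proof)] -/
theorem formM_block_eq (hm : 2 ≤ m) {b : Fin d → ℤ} (hb : ∀ k, 0 ≤ b k ∧ b k < r) (t t' : Amb (d := d) m r → ℝ)
    (htt' : ∀ i, ¬ Pb m b i → t i = t' i) :
    formM (pinB m b) (corner m b) m (ambE t') (tB hm hb t) =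
      ∑ p ∈ plaquettesIn (halfOpenBox d m), cq t (Plaq.shift (corner m b) p) := by
  unfold formM cq
  refine Finset.sum_congr rfl fun p hp => ?_
  congr 1
  obtain ⟨h1, h2, h3, h4⟩ := edges_mem_boxEdges hp
  have hg := fun e (he : e ∈ boxEdges d m) => glue_block_eq hm hb t t' htt' (shiftE_mem_boxEdgesAt.2 he)
  simp only [shiftE_apply] at hg
  simp only [sCirc, Plaq.shift_fst, Plaq.shift_snd]
  rw [add_right_comm p.1 (corner m b) (Pi.single p.2.1 1), add_right_comm p.1 (corner m b) (Pi.single p.2.2 1),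
    hg _ h1, hg _ h2, hg _ h3, hg _ h4]

/-- Plaquette costs only read the four edges: if `t` and `t'` agree on all free ambient edges among
the edges of `q`, the costs agree. [folklore] -/
theorem cq_congr (t t' : Amb (d := d) m r → ℝ) (q : Plaq d)
    (h : ∀ i : Amb (d := d) m r, ((q.1, q.2.1) = i.1.1 ∨ (q.1 + Pi.single q.2.1 1, q.2.2) = i.1.1 ∨
      (q.1 + Pi.single q.2.2 1, q.2.1) = i.1.1 ∨ (q.1, q.2.2) = i.1.1) → t i = t' i) :
    cq t q = cq t' q := by
  have hval : ∀ e : ZdEdge d, ((q.1, q.2.1) = e ∨ (q.1 + Pi.single q.2.1 1, q.2.2) = e ∨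
      (q.1 + Pi.single q.2.2 1, q.2.1) = e ∨ (q.1, q.2.2) = e) → ambE t e = ambE t' e := by
    intro e he
    by_cases hA : e ∈ boxEdgesAt (0 : ZSite d) (fineN m r)
    · by_cases hc : pinI e
      · simp [ambE, glue_apply_pin _ _ hA hc]
      · have h1 : ambE t e = t ⟨⟨e, hA⟩, hc⟩ := glue_apply_free _ _ ⟨⟨e, hA⟩, hc⟩
        have h2 : ambE t' e = t' ⟨⟨e, hA⟩, hc⟩ := glue_apply_free _ _ ⟨⟨e, hA⟩, hc⟩
        rw [h1, h2, h _ he]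
    · simp [ambE, glue_apply_of_not_mem _ _ hA]
  simp only [cq, sCirc]
  rw [hval _ (Or.inl rfl), hval _ (Or.inr (Or.inl rfl)), hval _ (Or.inr (Or.inr (Or.inl rfl))),
    hval _ (Or.inr (Or.inr (Or.inr rfl)))]

variable (m) in
/-- A plaquette touches the interior of block `b`: one of its edges is a non-boundary edge with
source block `b`. [cite: arXiv160201222, Thm. 14.3 (proof)] -/
def Touches (b : Fin d → ℤ) (q : Plaq d) : Prop :=
  ∃ e : ZdEdge d, (¬ IsBdry m e ∧ blk m e.1 = b) ∧ ((q.1, q.2.1) = e ∨ (q.1 + Pi.single q.2.1 1, q.2.2) = e ∨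
      (q.1 + Pi.single q.2.2 1, q.2.1) = e ∨ (q.1, q.2.2) = e)

/-- `Touches` is decidable (the existential ranges over the four edges). [folklore] -/
instance (b : Fin d → ℤ) (q : Plaq d) : Decidable (Touches (d := d) m b q) := by
  unfold Touches
  -- the existential is over the four edges
  have : Touches (d := d) m b q ↔ (¬ IsBdry m (q.1, q.2.1) ∧ blk m q.1 = b) ∨
      (¬ IsBdry m (q.1 + Pi.single q.2.1 1, q.2.2) ∧ blk m (q.1 + Pi.single q.2.1 1) = b) ∨
      (¬ IsBdry m (q.1 + Pi.single q.2.2 1, q.2.1) ∧ blk m (q.1 + Pi.single q.2.2 1) = b) ∨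
      (¬ IsBdry m (q.1, q.2.2) ∧ blk m q.1 = b) := by
    unfold Touches
    constructor
    · rintro ⟨e, he, h | h | h | h⟩ <;> subst h
      · exact Or.inl he
      · exact Or.inr (Or.inl he)
      · exact Or.inr (Or.inr (Or.inl he))
      · exact Or.inr (Or.inr (Or.inr he))
    · rintro (h | h | h | h)
      · exact ⟨_, h, Or.inl rfl⟩
      · exact ⟨_, h, Or.inr (Or.inl rfl)⟩
      · exact ⟨_, h, Or.inr (Or.inr (Or.inl rfl))⟩
      · exact ⟨_, h, Or.inr (Or.inr (Or.inr rfl))⟩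
  rw [Touches] at this
  exact decidable_of_iff _ this.symm

/-- Costs of plaquettes not touching the interior of `b` do not depend on the interior values. [folklore] -/
theorem cq_eq_of_not_touches {b : Fin d → ℤ} (t t' : Amb (d := d) m r → ℝ) (htt' : ∀ i, ¬ Pb m b i → t i = t' i)
    {q : Plaq d} (hq : ¬ Touches m b q) : cq t q = cq t' q := by
  apply cq_congr
  intro i hi
  apply htt'
  intro hP
  exact hq ⟨i.1.1, hP, hi⟩

/-- The touching plaquettes of the fine box are exactly the touching plaquettes of the block. [cite: arXiv160201222, Thm. 14.3 (proof)] -/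
theorem filter_touches_eq (hm : 2 ≤ m) {b : Fin d → ℤ} (hb : ∀ k, 0 ≤ b k ∧ b k < r) :
    (plaquettesIn (halfOpenBox d (fineN m r))).filter (Touches m b) =
      ((plaquettesIn (halfOpenBox d m)).image (Plaq.shift (corner m b))).filter (Touches m b) := by
  ext q
  simp only [mem_filter, mem_image]
  constructor
  · rintro ⟨hq, ht⟩
    refine ⟨?_, ht⟩
    obtain ⟨e, ⟨hnb, hblk⟩, hqe⟩ := ht
    have hlt : q.2.1 < q.2.2 := (Plaq.mem_plaquettesIn.1 hq).2.1
    have h := shift_mem_of_touch hm hlt hnb hqe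
    rw [hblk] at h
    exact ⟨_, h, by ext <;> simp [Plaq.shift]⟩
  · rintro ⟨⟨p, hp, rfl⟩, ht⟩
    exact ⟨shift_mem_plaquettesIn_fine (by omega) hb hp, ht⟩

/-- **The form decomposition**: for configurations `t, t'` agreeing off the interior of `b`,
`M(t) + K₁ = M_b(t) + K₂` where `M_b(t)` is the block form of the transported configuration (with
boundary values read from `t'`) and `K₁, K₂` depend only on `t'`. [cite: arXiv160201222, Thm. 14.3 (proof)] -/
theorem formM_amb_add_eq (hm : 2 ≤ m) {b : Fin d → ℤ} (hb : ∀ k, 0 ≤ b k ∧ b k < r) (t t' : Amb (d := d) m r → ℝ)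
    (htt' : ∀ i, ¬ Pb m b i → t i = t' i) :
    formM pinI (0 : ZSite d) (fineN m r) 0 t +
        ∑ q ∈ ((plaquettesIn (halfOpenBox d m)).image (Plaq.shift (corner m b))).filter (fun q => ¬ Touches m b q), cq t' q =
      formM (pinB m b) (corner m b) m (ambE t') (tB hm hb t) +
        ∑ q ∈ (plaquettesIn (halfOpenBox d (fineN m r))).filter (fun q => ¬ Touches m b q), cq t' q := by
  rw [formM_amb, formM_block_eq hm hb t t' htt']
  rw [← Finset.sum_image (f := fun q => cq t q) (fun p _ q _ h => Plaq.shift_injective _ h)]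
  rw [← Finset.sum_filter_add_sum_filter_not (plaquettesIn (halfOpenBox d (fineN m r))) (Touches m b),
    ← Finset.sum_filter_add_sum_filter_not ((plaquettesIn (halfOpenBox d m)).image (Plaq.shift (corner m b))) (Touches m b),
    filter_touches_eq hm hb]
  have h1 : ∑ q ∈ (plaquettesIn (halfOpenBox d (fineN m r))).filter (fun q => ¬ Touches m b q), cq t q =
      ∑ q ∈ (plaquettesIn (halfOpenBox d (fineN m r))).filter (fun q => ¬ Touches m b q), cq t' q :=
    Finset.sum_congr rfl fun q hq => cq_eq_of_not_touches t t' htt' (mem_filter.1 hq).2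
  have h2 : ∑ q ∈ ((plaquettesIn (halfOpenBox d m)).image (Plaq.shift (corner m b))).filter (fun q => ¬ Touches m b q), cq t q =
      ∑ q ∈ ((plaquettesIn (halfOpenBox d m)).image (Plaq.shift (corner m b))).filter (fun q => ¬ Touches m b q), cq t' q :=
    Finset.sum_congr rfl fun q hq => cq_eq_of_not_touches t t' htt' (mem_filter.1 hq).2
  rw [h1, h2]
  ring

/-- Pinned block edges carry boundary-or-zero ambient values: if `|t' i| ≤ η` on all boundary free
edges then `|t̂'(e)| ≤ η` on every pinned edge of block `b`. [cite: arXiv160201222, Thm. 14.3 (proof)] -/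
theorem abs_ambE_le_of_pin (hm : 2 ≤ m) {b : Fin d → ℤ} (hb : ∀ k, 0 ≤ b k ∧ b k < r) (t' : Amb (d := d) m r → ℝ) {η : ℝ} (hη : 0 ≤ η)
    (hbd : ∀ i : Amb (d := d) m r, IsBdry m i.1.1 → |t' i| ≤ η) :
    ∀ e ∈ boxEdgesAt (corner m b) m, pinB m b e → |ambE t' e| ≤ η := by
  intro e he hp
  have heA : e ∈ boxEdgesAt (0 : ZSite d) (fineN m r) := by
    rw [mem_boxEdgesAt_zero]; exact boxEdgesAt_subset (by omega) hb he
  by_cases hc : pinI e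
  · simp [ambE, glue_apply_pin _ _ heA hc, hη]
  · have h1 : ambE t' e = t' ⟨⟨e, heA⟩, hc⟩ := glue_apply_free _ _ ⟨⟨e, heA⟩, hc⟩
    rw [h1]
    apply hbd
    simp only [pinB] at hp
    rcases hp with h | h | h
    · exact absurd h hc
    · exact h
    · by_contra hnb
      exact h (blk_eq_of_mem_of_not_isBdry hm he hnb)

end Multiscale

end LatticeMaxwell

end Literature.MathematicalPhysics.QuantumFieldTheory
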